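import Summits.QuantumFields.YangMills.Theorems.BalabanUVNodesSpineReadingOfRecord13CoPHKComponentSizeBlocksFreshTowerLabel
import Literature.MathematicalPhysics.QuantumFieldTheory.Balaban1983to89.Node00.IndexMapCollarMetric

/-!
# THE REPAIRED PER-HISTORY LETTER: for a cube `c` FAR from the old large-field region `Z_m(π₀)` (≥ `25·sideD m` in some coordinate from each of its points), the one-step
# extensions of `π₀` whose new large-field region MEETS `c` weigh at most the one-step mass of the labels carrying a NEW large-field cube (`P ∪ Q ∪ R`) within `25·sideD m` of
# `c` — so a single large-field suppression letter on THAT mass (hLFc, [LF-II] (1.79)'s new-region factor summed over the candidate cubes) gives the fresh letter LOCATED-4 asked for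

Cell `pub-ymgap`, YM-PLAN Track A (HUMAN RULING D-0062; width push D-0149); seat `pub-ymgap-dag-n20-d` (R134 (a) N20 NE7b s3 = the U5d ∕ `crOfRecord₁₃` lineage, its declarer)
gen 38.  `--kind proof --supports stmt-QuantumFields-27366 --as helper` (K3⁸); COUNT-NEUTRAL; THEOREMS ONLY (0 `def`).  [III] = [Balaban1988Convergent]; [LF-II] = [Balaban1989LargeFieldII].
Companion of `…BlocksFreshTowerFibreVacuity` (p766147: hFA — charged on cubes in the collar — is degenerate), `…BlocksFreshTowerLabel` (p766321: label currency, `S_C(s)`),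
`Node00.IndexMapCollarRadius` ∕ `Node00.IndexMapCollarMetric` (p766498 ∕ p766768: outside the `24`-collar of `Z_k` the new large-field region is within `25·sideD k` of a label cube).

WHAT IS HERE.  §1 (of record, pointwise in `(U,V′)`) ★ `sum_filter_meets_chi_mul_wOfRecord_le_nearLabelSum`: for `s`, a site set `c` with every point of `Z_k = Zreg s` at coordinate
distance `≥ 25·sideD k` from every point of `c`, the resummed weights of the class `M_c(s) = {s′ : s′.init = s, c ∩ Λ_{k+1}(s′)ᶜ ≠ ∅}` are at most the NEAR-LABEL SUM
`F_T(U,V′) = Σ_{t ∈ T} χ_{k+1}(σ s t)(V′)·ω s t (U,V′)` over ANY label set `T` containing every label with a cube of `P_t ∪ Q_t ∪ R_t` within `25·sideD k` of `c` (fibrewise regrouping +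
the metric collar radius; labels `≥ 0` under `0 ≤ ζ`);
`nearLabelSum_nonneg ∕ _le_one ∕ measurable_nearLabelSum(_graph)` (any label set `T`; under `0 ≤ ζ` ∕ `Σ|ζ| ≤ 1` ∕ (H-U), (H-ζ)).  §2 (generic `P, G, D, avg`) ★ `sum_integral_chi_texpASucc_le_of_pointwise_fn` (gen 38's
transport lemma with a bound `φ(U)` on the graph instead of `f(avg U)`).  §3 ★★ `sum_meets_integral_chi_tstepOfRecord_le` (pre-𝐑, of record).  §4 ★★★
`sum_meets_classWeightOfDatum₉_succ_le_of_ppSelId ∕ _of_ppSelLive` (F3's dressed class weights: `Σ_{M_c(s)} cw_{k+1} ≤ ∫ χ_k(s)·slot_k(s)·F_c(U, avg U) dU`) and ★★★★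
`sum_meets_classWeightOfDatum₉_succ_le_of_nearLabelLetter_of_ppSelLive` — THE REPAIRED FRESH LETTER: GIVEN hLFc «`∫ χ_k(s)·slot_k(s)·F_c(U, avg U) ≤ δ·cw_k(s)`» (the one-step mass of
the labels with a new large-field cube near `c`, against the history's own mass — (1.79)'s factor `e^{−p₀(g_k)}` per cube times the `≈ (51·sideD k ∕ sideχ k)^4·3` candidate cubes, in
print), `Σ_{s′ ∈ M_c(s)} cw_{k+1}(s′) ≤ δ·cw_k(s)`.

HONEST FRAMING.  [bookkeeping] finite sums + Fubini + torus geometry BY NAME; hLFc is a HYPOTHESIS (inhabited for no family today; (1.79)'s KIND; an ESTIMATE on Theorem 1 [III]'s form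
of the slots); NO weight is bounded, NO estimate proved; nothing of Bałaban's asserted; NE7 ∕ NE7b ∕ NE7c NOT PRINTED for `d = 4` ∕ NOT proved; no `Provisos₁₃CoPH` ∕ `Stage9Params.Provisos`
inhabitant claimed (K0⁷ OPEN); K3⁸ v7 untouched; N19 ∕ N20 ∕ N21 ∕ N27 NOT discharged; counts UNMOVED (typed 28∕28 · discharged 8∕27); by LOCATED-4 (iii′) an assembly of this letter to
`RelWeightBound` at the live pin serves a bounded age cut only; one finite four-torus programme at fixed `ε` — NOT ℝ⁴, NOT OS, NOT a mass gap, NOT the Clay problem.  No `def`, no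
`instance`, no `notation`, no `sorry`; no decl below carries a cite tag.
-/

noncomputable section

open MeasureTheory
open scoped BigOperators
open Finset

namespace YMDAG.UVSplit

open Literature.MathematicalPhysics.QuantumFieldTheory.Balaban1983to89
open Literature.MathematicalPhysics.QuantumFieldTheory.Balaban1983to89.T4Continuum
open Literature.MathematicalPhysics.QuantumFieldTheory.Balaban1983to89.T4AveragingDisintegration
open Literature.MathematicalPhysics.QuantumFieldTheory.Balaban1983to89.Node00
open Literature.MathematicalPhysics.QuantumFieldTheory.Balaban1983to89.B14.Eq218Concrete
open Literature.MathematicalPhysics.QuantumFieldTheory.Balaban1983to89.B15Claim189LambdaPin (coordDist)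
open Literature.MathematicalPhysics.QuantumFieldTheory.Balaban1983to89.T4FiniteEpsInhabited
open Summit.QuantumFields.YangMills.BalabanUVNodes.N19MGFRoadLiveSelectorTower (classWeightOfDatum₉_ppSelLive_eq_ppSelId dressedSlotsOfDatum₉_ppSelLive_eq_ppSelId
  measurable_dressedSlotsOfDatum₉ dressedSlotsOfDatum₉_nonneg)

/-! ## §1 Of record, pointwise: the class «`c` meets `Z_{k+1}`» against the near-label sum -/

section Pointwise

variable (F : T4Family) (N : ℕ) [NeZero N] (ν : Stage7Numerics) (M : ℕ) (A₁ : ℝ) (p : B12.RunParams) (g : ℕ → ℝ) (k : ℕ)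

open scoped Classical in
/-- ★ **THE CLASS «`c` MEETS THE NEW LARGE-FIELD REGION» AGAINST THE NEAR-LABEL SUM, POINTWISE.**  For a history `s`, a site set `c` each of whose points is at coordinate distance
`≥ 25·sideD k` (in some coordinate) from every point of `Z_k = Zreg s`, ζ-unity's companion `0 ≤ ζ`, and `0 < sideD k`:
`Σ_{s′ : s′.init = s, c ∩ Λ_{k+1}(s′)ᶜ ≠ ∅} χ_{k+1}(s′)(V′)·w(s′)(U,V′) ≤ Σ_{t : ∃ q ∈ P_t ∪ Q_t ∪ R_t, ∃ y ∈ □_q, ∃ x ∈ c, ∀ i, coordDist y x i + 1 ≤ 25·sideD k} χ_{k+1}(σ s t)(V′)·ω s t (U,V′)`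
— the producing labels of the class carry a new large-field cube near `c` (`Node00.exists_near_label_of_mem_compl_Λ_succ_σOfRecord_of_far`), label terms are `≥ 0`. [bookkeeping] -/
theorem sum_filter_meets_chi_mul_wOfRecord_le_nearLabelSum {ζ : ZetaOfRecord F N ν M} (hζ0 : ∀ p g k s Pl Ql RS U V', 0 ≤ ζ p g k s Pl Ql RS U V')
    (hsD : 0 < sideD F ν M p g k) (s : SeqOfRecord F ν M g p.K k) (c : Set (Site (F.P p.K) 0))
    (hfar : ∀ x ∈ c, ∀ z ∈ Zreg F ν M p g k s, ∃ i, 25 * sideD F ν M p g k ≤ coordDist z x i)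
    (T : Finset (LbOfRecord F ν p g k)) (hT : ∀ t : LbOfRecord F ν p g k, (∃ q ∈ t.1 ∪ (t.2.1 ∪ t.2.2.1), ∃ y ∈ cubeχ F ν p g k q, ∃ x ∈ c,
      ∀ i, coordDist y x i + 1 ≤ 25 * sideD F ν M p g k) → t ∈ T)
    (U : GaugeField (F.P p.K) k (SU N)) (V' : GaugeField (F.P p.K) (k + 1) (SU N)) :
    ∑ s' ∈ Finset.univ.filter (fun s' : SeqOfRecord F ν M g p.K (k + 1) => s'.init = s ∧ ∃ x ∈ c, x ∈ (s'.Λ (k + 1))ᶜ),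
        chiSeqOfRecord F N ν M g p.K (k + 1) s' V' * wOfRecord F N ν M A₁ ζ p g k s' U V' ≤
      ∑ t ∈ T, chiSeqOfRecord F N ν M g p.K (k + 1) (σOfRecord F ν M p g k s t) V' * ωOfRecord F N ν M p g k A₁ ζ s t U V' := by
  classical
  set S := Finset.univ.filter (fun s' : SeqOfRecord F ν M g p.K (k + 1) => s'.init = s ∧ ∃ x ∈ c, x ∈ (s'.Λ (k + 1))ᶜ) with hS
  set gl : LbOfRecord F ν p g k → ℝ := fun t =>
    chiSeqOfRecord F N ν M g p.K (k + 1) (σOfRecord F ν M p g k s t) V' * ωOfRecord F N ν M p g k A₁ ζ s t U V' with hgl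
  -- each member's term is the sum of its producing labels' terms
  have hmem : ∀ s' ∈ S, chiSeqOfRecord F N ν M g p.K (k + 1) s' V' * wOfRecord F N ν M A₁ ζ p g k s' U V' =
      ∑ t ∈ Finset.univ.filter (fun t : LbOfRecord F ν p g k => σOfRecord F ν M p g k s t = s'), gl t := by
    intro s' hs'
    rw [wOfRecord_apply, resumWeights, (Finset.mem_filter.1 hs').2.1, Finset.mul_sum]
    exact Finset.sum_congr rfl fun t ht => by rw [hgl]; simp only; rw [(Finset.mem_filter.1 ht).2]
  rw [Finset.sum_congr rfl hmem]
  have hfib : ∑ s' ∈ S, ∑ t ∈ Finset.univ.filter (fun t : LbOfRecord F ν p g k => σOfRecord F ν M p g k s t = s'), gl t =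
      ∑ t ∈ Finset.univ.filter (fun t : LbOfRecord F ν p g k => σOfRecord F ν M p g k s t ∈ S), gl t := by
    rw [← Finset.sum_fiberwise_of_maps_to (s := Finset.univ.filter (fun t : LbOfRecord F ν p g k => σOfRecord F ν M p g k s t ∈ S)) (t := S)
      (g := fun t => σOfRecord F ν M p g k s t) (fun t ht => (Finset.mem_filter.1 ht).2)]
    refine Finset.sum_congr rfl fun s' hs' => Finset.sum_congr ?_ (fun _ _ => rfl)
    ext t
    simp only [Finset.mem_filter, Finset.mem_univ, true_and]
    exact ⟨fun h => ⟨by rw [h]; exact hs', h⟩, fun h => h.2⟩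
  rw [hfib]
  -- the producing labels of the class carry a new large-field cube near `c`
  have hsub : Finset.univ.filter (fun t : LbOfRecord F ν p g k => σOfRecord F ν M p g k s t ∈ S) ⊆ T := by
    intro t ht
    have h := (Finset.mem_filter.1 ht).2
    rw [hS, Finset.mem_filter] at h
    obtain ⟨x, hxc, hxZ⟩ := h.2.2
    obtain ⟨y, hy, hnear⟩ := exists_near_label_of_mem_compl_Λ_succ_σOfRecord_of_far hsD s t hxZ (fun z hz => hfar x hxc z hz)
    refine hT t ?_
    -- `y` lies in some cube `q` of `P ∪ Q ∪ R`
    rcases hy with hy | hy | hy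
    · obtain ⟨q, hq, hyq⟩ := Set.mem_iUnion₂.1 hy
      exact ⟨q, Finset.mem_union_left _ hq, y, hyq, x, hxc, hnear⟩
    · obtain ⟨q, hq, hyq⟩ := Set.mem_iUnion₂.1 hy
      exact ⟨q, Finset.mem_union_right _ (Finset.mem_union_left _ hq), y, hyq, x, hxc, hnear⟩
    · obtain ⟨q, hq, hyq⟩ := Set.mem_iUnion₂.1 hy
      exact ⟨q, Finset.mem_union_right _ (Finset.mem_union_right _ hq), y, hyq, x, hxc, hnear⟩
  refine Finset.sum_le_sum_of_subset_of_nonneg hsub fun t _ _ => ?_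
  exact mul_nonneg (chiSeqOfRecord_nonneg F N ν M g p.K (k + 1) _ V') (ωOfRecord_nonneg F N ν M p g k A₁ hζ0 s t U V')

/-- A partial label sum is non-negative (`0 ≤ ζ`). [bookkeeping] -/
theorem nearLabelSum_nonneg {ζ : ZetaOfRecord F N ν M} (hζ0 : ∀ p g k s Pl Ql RS U V', 0 ≤ ζ p g k s Pl Ql RS U V') (s : SeqOfRecord F ν M g p.K k)
    (T : Finset (LbOfRecord F ν p g k)) (U : GaugeField (F.P p.K) k (SU N)) (V' : GaugeField (F.P p.K) (k + 1) (SU N)) :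
    0 ≤ ∑ t ∈ T, chiSeqOfRecord F N ν M g p.K (k + 1) (σOfRecord F ν M p g k s t) V' * ωOfRecord F N ν M p g k A₁ ζ s t U V' :=
  Finset.sum_nonneg fun t _ => mul_nonneg (chiSeqOfRecord_nonneg F N ν M g p.K (k + 1) _ V') (ωOfRecord_nonneg F N ν M p g k A₁ hζ0 s t U V')

/-- A partial label sum is at most `1` (`Σ_t |ω s t| ≤ 1`, `|χ| ≤ 1`). [bookkeeping] -/
theorem nearLabelSum_le_one {ζ : ZetaOfRecord F N ν M} (hζa : IsZetaAbsLeOne F N ν M ζ) (s : SeqOfRecord F ν M g p.K k) (T : Finset (LbOfRecord F ν p g k))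
    (U : GaugeField (F.P p.K) k (SU N)) (V' : GaugeField (F.P p.K) (k + 1) (SU N)) :
    ∑ t ∈ T, chiSeqOfRecord F N ν M g p.K (k + 1) (σOfRecord F ν M p g k s t) V' * ωOfRecord F N ν M p g k A₁ ζ s t U V' ≤ 1 := by
  classical
  refine le_trans (Finset.sum_le_sum fun t _ => ?_) ((Finset.sum_le_sum_of_subset_of_nonneg (Finset.subset_univ T) fun t _ _ => abs_nonneg _).trans
    (sum_abs_ωOfRecord_le_one F N ν M p g k A₁ hζa s U V'))
  refine (le_abs_self _).trans ?_
  rw [abs_mul]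
  exact mul_le_of_le_one_left (abs_nonneg _) (abs_chiSeqOfRecord_le_one F N ν M g p.K (k + 1) _ V')

/-- A partial label sum is jointly measurable in `(V′, U)` under (H-U) and (H-ζ). [bookkeeping] -/
theorem measurable_nearLabelSum (hU : LocalBgMeasurable F N ν) {ζ : ZetaOfRecord F N ν M} (hζm : ZetaMeasurable F N ζ) (s : SeqOfRecord F ν M g p.K k)
    (T : Finset (LbOfRecord F ν p g k)) :
    Measurable (fun z : GaugeField (F.P p.K) (k + 1) (SU N) × GaugeField (F.P p.K) k (SU N) =>
      ∑ t ∈ T, chiSeqOfRecord F N ν M g p.K (k + 1) (σOfRecord F ν M p g k s t) z.1 * ωOfRecord F N ν M p g k A₁ ζ s t z.2 z.1) :=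
  Finset.measurable_sum _ fun t _ => ((measurable_chiSeqOfRecord_of_localBg hU M g p.K (k + 1) _).comp measurable_fst).mul
    (measurable_ωOfRecord_of_localBg hU M p g k A₁ hζm s t)

/-- A partial label sum read on the graph of the averaging of record, `U ↦ F(U, avg U)`, is measurable under (H-U) and (H-ζ). [bookkeeping] -/
theorem measurable_nearLabelSum_graph (hU : LocalBgMeasurable F N ν) {ζ : ZetaOfRecord F N ν M} (hζm : ZetaMeasurable F N ζ) (s : SeqOfRecord F ν M g p.K k)
    (T : Finset (LbOfRecord F ν p g k)) :
    Measurable (fun U : GaugeField (F.P p.K) k (SU N) =>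
      ∑ t ∈ T, chiSeqOfRecord F N ν M g p.K (k + 1) (σOfRecord F ν M p g k s t) ((avOfRecord F N p.K k).avg U) *
        ωOfRecord F N ν M p g k A₁ ζ s t U ((avOfRecord F N p.K k).avg U)) := by
  refine Finset.measurable_sum T fun t _ => Measurable.mul ?_ ?_
  · exact (measurable_chiSeqOfRecord_of_localBg hU M g p.K (k + 1) (σOfRecord F ν M p g k s t)).comp (avOfRecord_measurable F N p.K k)
  · -- elaborate the composition WITHOUT the expected type (else `?g ∘ ?f =?= fun U => ω U (avg U)` is a non-pattern unification that times out)
    have h := (measurable_ωOfRecord_of_localBg hU M p g k A₁ hζm s t).comp (measurable_graphMap (avOfRecord_measurable F N p.K k))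
    exact h

end Pointwise

/-! ## §2 Generic: a sub-family of one `init`-fibre of the 𝐓-step under a pointwise bound by a function of the fine field -/

section Generic

variable {P : Params} {G : Type*} [GaugeGroup G] [MeasurableSpace G] [HaarData G] [StandardBorelSpace G]
variable {α : Type*} {D : ℕ → Set (Set α)} {k : ℕ}
variable {avg : GaugeField P k G → GaugeField P (k + 1) G}

/-- ★ **A SUB-FAMILY OF ONE `init`-FIBRE OF THE 𝐓-STEP UNDER A POINTWISE BOUND `φ(U)` ON THE GRAPH** (`…BlocksFreshTowerLabel.sum_integral_chi_texpASucc_le_of_pointwise` with the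
bound a measurable bounded function of the fine field rather than of its average): `Σ_{s′ ∈ S} ∫ χ_{k+1}(s′)·texpASucc(s′) ≤ ∫ χ_k(s)(U)·T(s)(U)·φ(U) dU`. [bookkeeping] -/
theorem sum_integral_chi_texpASucc_le_of_pointwise_fn (havg : Measurable avg) (hac : HaarAC avg) (χk T : Seq D k → Density P k G)
    (χk1 : Seq D (k + 1) → Density P (k + 1) G) (w : Seq D (k + 1) → GaugeField P k G → GaugeField P (k + 1) G → ℝ)
    (s : Seq D k) (hT : Integrable (fun U => χk s U * T s U) (fieldMeasure P k G)) (hT0 : ∀ U, 0 ≤ χk s U * T s U)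
    (hw : ∀ s', Measurable (fun z : GaugeField P (k + 1) G × GaugeField P k G => w s' z.2 z.1))
    (hwb : ∀ s' U V', |w s' U V'| ≤ 1) (hχ : ∀ s', Measurable (χk1 s')) (hχb : ∀ s' V', |χk1 s' V'| ≤ 1)
    (S : Finset (Seq D (k + 1))) (hS : ∀ s' ∈ S, s'.init = s)
    {φ : GaugeField P k G → ℝ} (hφ : Measurable φ) (hφC : ∃ C, ∀ U, |φ U| ≤ C)
    (hpt : ∀ U, ∑ s' ∈ S, χk1 s' (avg U) * w s' U (avg U) ≤ φ U) :
    ∑ s' ∈ S, ∫ V, χk1 s' V * texpASucc avg χk T w s' V ∂(fieldMeasure P (k + 1) G)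
      ≤ ∫ U, χk s U * T s U * φ U ∂(fieldMeasure P k G) := by
  classical
  obtain ⟨C, hC⟩ := hφC
  have hb : ∀ s', Measurable (fun z : GaugeField P (k + 1) G × GaugeField P k G => w s' z.2 z.1 * χk1 s' z.1) :=
    fun s' => (hw s').mul ((hχ s').comp measurable_fst)
  have hbC : ∀ s' (z : GaugeField P (k + 1) G × GaugeField P k G), ‖w s' z.2 z.1 * χk1 s' z.1‖ ≤ 1 := fun s' z => by
    rw [Real.norm_eq_abs, abs_mul, ← one_mul (1 : ℝ)]; exact mul_le_mul (hwb _ _ _) (hχb _ _) (abs_nonneg _) zero_le_one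
  have hTs : ∀ s' ∈ S, Integrable (fun U => χk s'.init U * T s'.init U) (fieldMeasure P k G) := fun s' hs' => by rw [hS s' hs']; exact hT
  have e : ∀ s' V, χk1 s' V * texpASucc avg χk T w s' V =
      (avgDensity avg V : ℝ) * ∫ U, (χk s'.init U * T s'.init U) * (w s' U V * χk1 s' V) ∂(avgKernel avg V) := by
    intro s' V
    have : ∫ U, (χk s'.init U * T s'.init U) * (w s' U V * χk1 s' V) ∂(avgKernel avg V)
        = (∫ U, w s' U V * (χk s'.init U * T s'.init U) ∂(avgKernel avg V)) * χk1 s' V := by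
      rw [← integral_mul_const]; exact integral_congr_ae (ae_of_all _ fun U => by ring)
    rw [this, texpASucc_apply]; ring
  have hstep : ∑ s' ∈ S, ∫ V, χk1 s' V * texpASucc avg χk T w s' V ∂(fieldMeasure P (k + 1) G) =
      ∫ U, ∑ s' ∈ S, (χk s'.init U * T s'.init U) * (w s' U (avg U) * χk1 s' (avg U)) ∂(fieldMeasure P k G) := by
    calc ∑ s' ∈ S, ∫ V, χk1 s' V * texpASucc avg χk T w s' V ∂(fieldMeasure P (k + 1) G)
        = ∑ s' ∈ S, ∫ V, (avgDensity avg V : ℝ) *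
            ∫ U, (χk s'.init U * T s'.init U) * (w s' U V * χk1 s' V) ∂(avgKernel avg V) ∂(fieldMeasure P (k + 1) G) :=
          Finset.sum_congr rfl fun s' _ => integral_congr_ae (ae_of_all _ (e s'))
      _ = ∑ s' ∈ S, ∫ U, (χk s'.init U * T s'.init U) * (w s' U (avg U) * χk1 s' (avg U)) ∂(fieldMeasure P k G) :=
          Finset.sum_congr rfl fun s' hs' => integral_transport_piece havg hac (hTs s' hs') (hb s') (hbC s')
      _ = ∫ U, ∑ s' ∈ S, (χk s'.init U * T s'.init U) * (w s' U (avg U) * χk1 s' (avg U)) ∂(fieldMeasure P k G) :=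
          (integral_finsetSum _ fun s' hs' => integrable_graph_piece havg (hTs s' hs') (hb s') (hbC s')).symm
  rw [hstep]
  have hφi : Integrable (fun U => χk s U * T s U * φ U) (fieldMeasure P k G) :=
    hT.mul_bdd hφ.aestronglyMeasurable (Filter.Eventually.of_forall fun U => by rw [Real.norm_eq_abs]; exact hC _)
  refine integral_mono (integrable_finsetSum _ fun s' hs' => integrable_graph_piece havg (hTs s' hs') (hb s') (hbC s')) hφi fun U => ?_
  have hrew : ∑ s' ∈ S, (χk s'.init U * T s'.init U) * (w s' U (avg U) * χk1 s' (avg U)) =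
      (χk s U * T s U) * ∑ s' ∈ S, χk1 s' (avg U) * w s' U (avg U) := by
    rw [Finset.mul_sum]; exact Finset.sum_congr rfl fun s' hs' => by rw [hS s' hs']; ring
  show ∑ s' ∈ S, (χk s'.init U * T s'.init U) * (w s' U (avg U) * χk1 s' (avg U)) ≤ χk s U * T s U * φ U
  rw [hrew]
  exact mul_le_mul_of_nonneg_left (hpt U) (hT0 U)

end Generic

/-! ## §3 Of record, pre-𝐑: the class «`c` meets `Z_{k+1}`» of the 𝐓-step against the transported near-label sum -/

section PreR

variable (F : T4Family) (N : ℕ) [NeZero N] (ν : Stage7Numerics) (M : ℕ) (A₁ : ℝ)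

open scoped Classical in
/-- ★★ **PRE-𝐑, OF RECORD** (`k < K`): for a level-`k` slot family `T ≥ 0` with integrable piece at `s`, (H-U), ζ-unity's companions `Σ|ζ| ≤ 1`, (H-ζ), `0 ≤ ζ`, `0 < sideD k`, and `c` far
from `Z_k`: `Σ_{s′ : s′.init = s, c ∩ Λ_{k+1}(s′)ᶜ ≠ ∅} ∫ χ_{k+1}(s′)·(𝐓-step T)(s′) ≤ ∫ χ_k(s)(U)·T(s)(U)·F_c(U, avg U) dU`, `F_c` the near-label sum of §1. [bookkeeping] -/
theorem sum_meets_integral_chi_tstepOfRecord_le (hU : LocalBgMeasurable F N ν) {ζ : ZetaOfRecord F N ν M} (hζa : IsZetaAbsLeOne F N ν M ζ)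
    (hζm : ZetaMeasurable F N ζ) (hζ0 : ∀ p g k s Pl Ql RS U V', 0 ≤ ζ p g k s Pl Ql RS U V') (p : B12.RunParams) (g : ℕ → ℝ) (k : ℕ) (hk : k < p.K)
    (hsD : 0 < sideD F ν M p g k) (T : SeqOfRecord F ν M g p.K k → Density (F.P p.K) k (SU N)) (hT0' : ∀ s U, 0 ≤ T s U) (s : SeqOfRecord F ν M g p.K k)
    (hT : Integrable (fun U => chiSeqOfRecord F N ν M g p.K k s U * T s U) (fieldMeasure (F.P p.K) k (SU N)))
    (c : Set (Site (F.P p.K) 0)) (hfar : ∀ x ∈ c, ∀ z ∈ Zreg F ν M p g k s, ∃ i, 25 * sideD F ν M p g k ≤ coordDist z x i)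
    (Tc : Finset (LbOfRecord F ν p g k)) (hTc : ∀ t : LbOfRecord F ν p g k, (∃ q ∈ t.1 ∪ (t.2.1 ∪ t.2.2.1), ∃ y ∈ cubeχ F ν p g k q, ∃ x ∈ c,
      ∀ i, coordDist y x i + 1 ≤ 25 * sideD F ν M p g k) → t ∈ Tc) :
    ∑ s' ∈ Finset.univ.filter (fun s' : SeqOfRecord F ν M g p.K (k + 1) => s'.init = s ∧ ∃ x ∈ c, x ∈ (s'.Λ (k + 1))ᶜ),
        ∫ V, chiSeqOfRecord F N ν M g p.K (k + 1) s' V * tstepOfRecord F N ν M (wOfRecord F N ν M A₁ ζ) p g k T s' V ∂(fieldMeasure (F.P p.K) (k + 1) (SU N))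
      ≤ ∫ U, chiSeqOfRecord F N ν M g p.K k s U * T s U *
          ∑ t ∈ Tc, chiSeqOfRecord F N ν M g p.K (k + 1) (σOfRecord F ν M p g k s t) ((avOfRecord F N p.K k).avg U) *
              ωOfRecord F N ν M p g k A₁ ζ s t U ((avOfRecord F N p.K k).avg U) ∂(fieldMeasure (F.P p.K) k (SU N)) := by
  have hφm := measurable_nearLabelSum_graph F N ν M A₁ p g k hU hζm s Tc
  refine sum_integral_chi_texpASucc_le_of_pointwise_fn (avOfRecord_measurable F N p.K k) (avOfRecord_haarAC F N p.K k hk) _ T _ _ s hT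
    (fun U => mul_nonneg (chiSeqOfRecord_nonneg F N ν M g p.K k s U) (hT0' s U))
    (fun s' => measurable_wOfRecord_of_localBg hU M A₁ hζm p g k s')
    (fun s' U V' => abs_wOfRecord_le_one F N ν M A₁ hζa p g k s' U V') (fun s' => measurable_chiSeqOfRecord_of_localBg hU M g p.K (k + 1) s')
    (fun s' V' => abs_chiSeqOfRecord_le_one F N ν M g p.K (k + 1) s' V') _ (fun s' hs' => (Finset.mem_filter.1 hs').2.1) hφm
    ⟨1, fun U => ?_⟩ fun U => ?_
  · rw [abs_of_nonneg (nearLabelSum_nonneg F N ν M A₁ p g k hζ0 s Tc U ((avOfRecord F N p.K k).avg U))]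
    exact nearLabelSum_le_one F N ν M A₁ p g k hζa s Tc U ((avOfRecord F N p.K k).avg U)
  · exact sum_filter_meets_chi_mul_wOfRecord_le_nearLabelSum F N ν M A₁ p g k hζ0 hsD s c hfar Tc hTc U ((avOfRecord F N p.K k).avg U)

end PreR

/-! ## §4 F3's dressed class weights: the repaired fresh letter at an identity- ∕ live-pinned tuple, from the near-label letter alone -/

section Dressed

variable {F : T4Family} {N : ℕ} [NeZero N]

open scoped Classical in
/-- ★★★ **AT AN IDENTITY-PINNED STAGE-9 TUPLE**: `Σ_{s′ : s′.init = s, c ∩ Λ_{k+1}(s′)ᶜ ≠ ∅} cw_{k+1}(s′) ≤ ∫ χ_k(s)·slot^{t}_k(s)·F_c(U, avg U) dU` for `c` far from `Z_k`, under (H-U),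
the ζ-laws `Σ|ζ| ≤ 1`, (H-ζ), `0 ≤ ζ` and `0 < sideD k` (the identity 𝐑-step never increases a slot; the pre-𝐑 pieces are integrable by K0c ∕ gen 37; §3). [bookkeeping] -/
theorem sum_meets_classWeightOfDatum₉_succ_le_of_ppSelId (ϑ : Stage9Params F N) (hid : ϑ.ppSel = ppSelIdOfRecord F ϑ.ν ϑ.τ9.M)
    (hU : LocalBgMeasurable F N ϑ.ν) (hζa : IsZetaAbsLeOne F N ϑ.ν ϑ.τ9.M ϑ.ζ)
    (hζm : ZetaMeasurable F N ϑ.ζ) (hζ0 : ∀ p g k s Pl Ql RS U V', 0 ≤ ϑ.ζ p g k s Pl Ql RS U V')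
    (D : FiniteEpsData F (SU N)) (hD : D.AvgMeasurable) (g₀ : ℕ → ℝ) (os : List (ULoop F)) (p : B12.RunParams) (g : ℕ → ℝ) (hg : g 0 = g₀ p.K)
    (k : ℕ) (hk : k < p.K) (hsD : 0 < sideD F ϑ.ν ϑ.τ9.M p g k) (t : ℝ) (s : SeqOfRecord F ϑ.ν ϑ.τ9.M g p.K k)
    (c : Set (Site (F.P p.K) 0)) (hfar : ∀ x ∈ c, ∀ z ∈ Zreg F ϑ.ν ϑ.τ9.M p g k s, ∃ i, 25 * sideD F ϑ.ν ϑ.τ9.M p g k ≤ coordDist z x i)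
    (Tc : Finset (LbOfRecord F ϑ.ν p g k)) (hTc : ∀ lb : LbOfRecord F ϑ.ν p g k, (∃ q ∈ lb.1 ∪ (lb.2.1 ∪ lb.2.2.1), ∃ y ∈ cubeχ F ϑ.ν p g k q, ∃ x ∈ c,
      ∀ i, coordDist y x i + 1 ≤ 25 * sideD F ϑ.ν ϑ.τ9.M p g k) → lb ∈ Tc) :
    ∑ s' ∈ Finset.univ.filter (fun s' : SeqOfRecord F ϑ.ν ϑ.τ9.M g p.K (k + 1) => s'.init = s ∧ ∃ x ∈ c, x ∈ (s'.Λ (k + 1))ᶜ),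
        classWeightOfDatum₉ F N ϑ D g₀ os p g (k + 1) t s'
      ≤ ∫ U, chiSeqOfRecord F N ϑ.ν ϑ.τ9.M g p.K k s U * dressedSlotsOfDatum₉ F N ϑ D g₀ os t p g k s U *
          ∑ lb ∈ Tc, chiSeqOfRecord F N ϑ.ν ϑ.τ9.M g p.K (k + 1) (σOfRecord F ϑ.ν ϑ.τ9.M p g k s lb) ((avOfRecord F N p.K k).avg U) *
              ωOfRecord F N ϑ.ν ϑ.τ9.M p g k ϑ.A₁ ϑ.ζ s lb U ((avOfRecord F N p.K k).avg U) ∂(fieldMeasure (F.P p.K) k (SU N)) := by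
  have hw0 : ∀ k s' U V', 0 ≤ wOfRecord₉ F N ϑ p g k s' U V' := fun k s' U V' => wOfRecord_nonneg F N ϑ.ν ϑ.τ9.M p g k ϑ.A₁ hζ0 s' U V'
  have hwb : ∀ k s' U V', |wOfRecord₉ F N ϑ p g k s' U V'| ≤ 1 := fun k s' U V' => abs_wOfRecord_le_one F N ϑ.ν ϑ.τ9.M ϑ.A₁ hζa p g k s' U V'
  have hwm : ∀ k s', Measurable (fun z : GaugeField (F.P p.K) (k + 1) (SU N) × GaugeField (F.P p.K) k (SU N) => wOfRecord₉ F N ϑ p g k s' z.2 z.1) :=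
    fun k s' => measurable_wOfRecord_of_localBg hU ϑ.τ9.M ϑ.A₁ hζm p g k s'
  have hχm : ∀ k s, Measurable (chiSeqOfRecord F N ϑ.ν ϑ.τ9.M g p.K k s) := fun k s => measurable_chiSeqOfRecord_of_localBg hU ϑ.τ9.M g p.K k s
  have hχb : ∀ k (s : SeqOfRecord F ϑ.ν ϑ.τ9.M g p.K k), ∀ᵐ U ∂(fieldMeasure (F.P p.K) k (SU N)), ‖chiSeqOfRecord F N ϑ.ν ϑ.τ9.M g p.K k s U‖ ≤ 1 :=
    fun k s => ae_of_all _ fun U => by rw [Real.norm_eq_abs]; exact abs_chiSeqOfRecord_le_one F N ϑ.ν ϑ.τ9.M g p.K k s U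
  have hTint : ∀ k, k ≤ p.K → ∀ s : SeqOfRecord F ϑ.ν ϑ.τ9.M g p.K k,
      Integrable (fun U => chiSeqOfRecord F N ϑ.ν ϑ.τ9.M g p.K k s U * dressedSlotsOfDatum₉ F N ϑ D g₀ os t p g k s U) (fieldMeasure (F.P p.K) k (SU N)) :=
    fun k hk s => (integrable_dressedSlotsOfDatum₉_of_ppSelId ϑ hid D hD g₀ os p g hg hw0 hwb hwm hχm t k hk s).bdd_mul (hχm k s).aestronglyMeasurable (hχb k s)
  have hd0 := dressedSlotsOfDatum₉_nonneg F N ϑ D g₀ os p g hw0 t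
  have hrec : dressedSlotsOfDatum₉ F N ϑ D g₀ os t p g (k + 1) =
      rstepSlotOfRecord F N ϑ.ν ϑ.τ9 ϑ.ppSel p g (k + 1)
        (tstepOfRecord F N ϑ.ν ϑ.τ9.M (wOfRecord₉ F N ϑ) p g k (dressedSlotsOfDatum₉ F N ϑ D g₀ os t p g k)) :=
    texpAOfRecordFrom_succ F N ϑ.ν ϑ.τ9.M _ (wOfRecord₉ F N ϑ) (rstepSlotOfRecord F N ϑ.ν ϑ.τ9 ϑ.ppSel) p g k
  have hle : ∀ s' : SeqOfRecord F ϑ.ν ϑ.τ9.M g p.K (k + 1), classWeightOfDatum₉ F N ϑ D g₀ os p g (k + 1) t s' ≤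
      ∫ V, chiSeqOfRecord F N ϑ.ν ϑ.τ9.M g p.K (k + 1) s' V *
        tstepOfRecord F N ϑ.ν ϑ.τ9.M (wOfRecord₉ F N ϑ) p g k (dressedSlotsOfDatum₉ F N ϑ D g₀ os t p g k) s' V ∂(fieldMeasure (F.P p.K) (k + 1) (SU N)) := by
    intro s'
    have hint' := (integrable_tstepOfRecord F N ϑ.ν ϑ.τ9.M hk (hwm k) (hwb k) (hTint k hk.le) s').bdd_mul
      (hχm (k + 1) s').aestronglyMeasurable (hχb (k + 1) s')
    unfold classWeightOfDatum₉
    refine integral_mono_of_nonneg (ae_of_all _ fun V => mul_nonneg (chiSeqOfRecord_nonneg F N ϑ.ν ϑ.τ9.M g p.K (k + 1) s' V) (hd0 (k + 1) s' V))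
      hint' (ae_of_all _ fun V => ?_)
    refine mul_le_mul_of_nonneg_left ?_ (chiSeqOfRecord_nonneg F N ϑ.ν ϑ.τ9.M g p.K (k + 1) s' V)
    rw [hrec, hid]
    exact rstepSlotOfRecord_ppSelId_le ϑ.ν ϑ.τ9 p g (k + 1) _ (tstepOfRecord_nonneg F N ϑ.ν ϑ.τ9.M (hw0 k) (hd0 k)) s' V
  refine (Finset.sum_le_sum fun s' _ => hle s').trans ?_
  exact sum_meets_integral_chi_tstepOfRecord_le F N ϑ.ν ϑ.τ9.M ϑ.A₁ hU (ζ := ϑ.ζ) hζa hζm hζ0 p g k hk hsD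
    (dressedSlotsOfDatum₉ F N ϑ D g₀ os t p g k) (fun s U => hd0 k s U) s (hTint k hk.le s) c hfar Tc hTc

open scoped Classical in
/-- ★★★ **AT A LIVE-PINNED STAGE-9 TUPLE**: the same, the class weights and slots at the live re-pin being those at the identity re-pin (n19). [bookkeeping] -/
theorem sum_meets_classWeightOfDatum₉_succ_le_of_ppSelLive (ϑ : Stage9Params F N) (E : B12.RunParams → ℝ)
    (hsel : ϑ.ppSel = ppSelLiveOfRecord F N ϑ.ν ϑ.τ9 E (wOfRecord₉ F N ϑ))
    (hU : LocalBgMeasurable F N ϑ.ν) (hζa : IsZetaAbsLeOne F N ϑ.ν ϑ.τ9.M ϑ.ζ)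
    (hζm : ZetaMeasurable F N ϑ.ζ) (hζ0 : ∀ p g k s Pl Ql RS U V', 0 ≤ ϑ.ζ p g k s Pl Ql RS U V')
    (D : FiniteEpsData F (SU N)) (hD : D.AvgMeasurable) (g₀ : ℕ → ℝ) (os : List (ULoop F)) (p : B12.RunParams) (g : ℕ → ℝ) (hg : g 0 = g₀ p.K)
    (k : ℕ) (hk : k < p.K) (hsD : 0 < sideD F ϑ.ν ϑ.τ9.M p g k) (t : ℝ) (s : SeqOfRecord F ϑ.ν ϑ.τ9.M g p.K k)
    (c : Set (Site (F.P p.K) 0)) (hfar : ∀ x ∈ c, ∀ z ∈ Zreg F ϑ.ν ϑ.τ9.M p g k s, ∃ i, 25 * sideD F ϑ.ν ϑ.τ9.M p g k ≤ coordDist z x i)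
    (Tc : Finset (LbOfRecord F ϑ.ν p g k)) (hTc : ∀ lb : LbOfRecord F ϑ.ν p g k, (∃ q ∈ lb.1 ∪ (lb.2.1 ∪ lb.2.2.1), ∃ y ∈ cubeχ F ϑ.ν p g k q, ∃ x ∈ c,
      ∀ i, coordDist y x i + 1 ≤ 25 * sideD F ϑ.ν ϑ.τ9.M p g k) → lb ∈ Tc) :
    ∑ s' ∈ Finset.univ.filter (fun s' : SeqOfRecord F ϑ.ν ϑ.τ9.M g p.K (k + 1) => s'.init = s ∧ ∃ x ∈ c, x ∈ (s'.Λ (k + 1))ᶜ),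
        classWeightOfDatum₉ F N ϑ D g₀ os p g (k + 1) t s'
      ≤ ∫ U, chiSeqOfRecord F N ϑ.ν ϑ.τ9.M g p.K k s U * dressedSlotsOfDatum₉ F N ϑ D g₀ os t p g k s U *
          ∑ lb ∈ Tc, chiSeqOfRecord F N ϑ.ν ϑ.τ9.M g p.K (k + 1) (σOfRecord F ϑ.ν ϑ.τ9.M p g k s lb) ((avOfRecord F N p.K k).avg U) *
              ωOfRecord F N ϑ.ν ϑ.τ9.M p g k ϑ.A₁ ϑ.ζ s lb U ((avOfRecord F N p.K k).avg U) ∂(fieldMeasure (F.P p.K) k (SU N)) := by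
  have hw0 : ∀ k s' U V', 0 ≤ wOfRecord₉ F N ϑ p g k s' U V' := fun k s' U V' => wOfRecord_nonneg F N ϑ.ν ϑ.τ9.M p g k ϑ.A₁ hζ0 s' U V'
  have hwm : ∀ k s', Measurable (fun z : GaugeField (F.P p.K) (k + 1) (SU N) × GaugeField (F.P p.K) k (SU N) => wOfRecord₉ F N ϑ p g k s' z.2 z.1) :=
    fun k s' => measurable_wOfRecord_of_localBg hU ϑ.τ9.M ϑ.A₁ hζm p g k s'
  have hχm : ∀ k s, Measurable (chiSeqOfRecord F N ϑ.ν ϑ.τ9.M g p.K k s) := fun k s => measurable_chiSeqOfRecord_of_localBg hU ϑ.τ9.M g p.K k s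
  have hcw := fun k t s => classWeightOfDatum₉_ppSelLive_eq_ppSelId F N ϑ D g₀ os p g E hsel hg hD hw0 hwm hχm k t s
  have hsl := dressedSlotsOfDatum₉_ppSelLive_eq_ppSelId F N ϑ D g₀ os p g E hsel hg hD hw0 hwm hχm t
  rw [Finset.sum_congr rfl fun s' _ => hcw (k + 1) t s']
  rw [integral_congr_ae (ae_of_all _ fun U => congrArg (fun x : ℝ => chiSeqOfRecord F N ϑ.ν ϑ.τ9.M g p.K k s U * x *
      ∑ lb ∈ Tc, chiSeqOfRecord F N ϑ.ν ϑ.τ9.M g p.K (k + 1) (σOfRecord F ϑ.ν ϑ.τ9.M p g k s lb) ((avOfRecord F N p.K k).avg U) *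
          ωOfRecord F N ϑ.ν ϑ.τ9.M p g k ϑ.A₁ ϑ.ζ s lb U ((avOfRecord F N p.K k).avg U)) (hsl k s U))]
  exact sum_meets_classWeightOfDatum₉_succ_le_of_ppSelId { ϑ with ppSel := ppSelIdOfRecord F ϑ.ν ϑ.τ9.M } rfl hU hζa hζm hζ0 D hD g₀ os p g hg k hk hsD t s c hfar Tc hTc

open scoped Classical in
/-- ★★★★ **THE REPAIRED PER-HISTORY FRESH LETTER, FROM THE NEAR-LABEL LETTER ALONE.**  At a live-pinned Stage-9 tuple under (H-U), the ζ-laws, `0 ≤ ζ`, `0 < sideD k`: for a history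
`s`, a site set `c` FAR from `Z_k(s)` (`≥ 25·sideD k` in some coordinate from each point of `c` to each point of `Z_k`), GIVEN hLFc — «the one-step mass of the labels carrying a NEW
large-field cube (P, Q or R) within `25·sideD k` of `c`, against the history's class density, is at most `δ·cw_k(s)`» ([LF-II] (1.79) p. 383's new-region factor, summed over the
candidate cubes; an ESTIMATE, nobody's theorem today) —: `Σ_{s′ : s′.init = s, c ∩ Z_{k+1}(s′) ≠ ∅} cw_{k+1}(s′) ≤ δ·cw_k(s)`.  This is the letter LOCATED-4 asks for in place of hFA:
charged only FAR from the old region, witnessed by a label cube (p766768), priced by the label sum (p766321). [bookkeeping] -/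
theorem sum_meets_classWeightOfDatum₉_succ_le_of_nearLabelLetter_of_ppSelLive (ϑ : Stage9Params F N) (E : B12.RunParams → ℝ)
    (hsel : ϑ.ppSel = ppSelLiveOfRecord F N ϑ.ν ϑ.τ9 E (wOfRecord₉ F N ϑ))
    (hU : LocalBgMeasurable F N ϑ.ν) (hζa : IsZetaAbsLeOne F N ϑ.ν ϑ.τ9.M ϑ.ζ)
    (hζm : ZetaMeasurable F N ϑ.ζ) (hζ0 : ∀ p g k s Pl Ql RS U V', 0 ≤ ϑ.ζ p g k s Pl Ql RS U V')
    (D : FiniteEpsData F (SU N)) (hD : D.AvgMeasurable) (g₀ : ℕ → ℝ) (os : List (ULoop F)) (p : B12.RunParams) (g : ℕ → ℝ) (hg : g 0 = g₀ p.K)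
    (k : ℕ) (hk : k < p.K) (hsD : 0 < sideD F ϑ.ν ϑ.τ9.M p g k) (t : ℝ) (s : SeqOfRecord F ϑ.ν ϑ.τ9.M g p.K k)
    (c : Set (Site (F.P p.K) 0)) (hfar : ∀ x ∈ c, ∀ z ∈ Zreg F ϑ.ν ϑ.τ9.M p g k s, ∃ i, 25 * sideD F ϑ.ν ϑ.τ9.M p g k ≤ coordDist z x i)
    (Tc : Finset (LbOfRecord F ϑ.ν p g k)) (hTc : ∀ lb : LbOfRecord F ϑ.ν p g k, (∃ q ∈ lb.1 ∪ (lb.2.1 ∪ lb.2.2.1), ∃ y ∈ cubeχ F ϑ.ν p g k q, ∃ x ∈ c,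
      ∀ i, coordDist y x i + 1 ≤ 25 * sideD F ϑ.ν ϑ.τ9.M p g k) → lb ∈ Tc) {δ : ℝ}
    (hLFc : ∫ U, chiSeqOfRecord F N ϑ.ν ϑ.τ9.M g p.K k s U * dressedSlotsOfDatum₉ F N ϑ D g₀ os t p g k s U *
          ∑ lb ∈ Tc, chiSeqOfRecord F N ϑ.ν ϑ.τ9.M g p.K (k + 1) (σOfRecord F ϑ.ν ϑ.τ9.M p g k s lb) ((avOfRecord F N p.K k).avg U) *
              ωOfRecord F N ϑ.ν ϑ.τ9.M p g k ϑ.A₁ ϑ.ζ s lb U ((avOfRecord F N p.K k).avg U) ∂(fieldMeasure (F.P p.K) k (SU N))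
        ≤ δ * classWeightOfDatum₉ F N ϑ D g₀ os p g k t s) :
    ∑ s' ∈ Finset.univ.filter (fun s' : SeqOfRecord F ϑ.ν ϑ.τ9.M g p.K (k + 1) => s'.init = s ∧ ∃ x ∈ c, x ∈ (s'.Λ (k + 1))ᶜ),
        classWeightOfDatum₉ F N ϑ D g₀ os p g (k + 1) t s' ≤ δ * classWeightOfDatum₉ F N ϑ D g₀ os p g k t s :=
  (sum_meets_classWeightOfDatum₉_succ_le_of_ppSelLive ϑ E hsel hU hζa hζm hζ0 D hD g₀ os p g hg k hk hsD t s c hfar Tc hTc).trans hLFc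

end Dressed

end YMDAG.UVSplit

end
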